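import Mathlib
import HarnessLib
import Summits.CriticalPhenomena.PercolationContinuityZ3.Theorems.PercNearOneGluingNoHeavyQuantFarDecLawSums

/-!
# QUANT lane R8, front "FAR beyond trees", layer one — CYC-DEC at the law level, file 4: THE STEP IDENTITIES AND MODEL FACTS
# (removing hub 1: the block numbers of `C` versus those of `C.shift`, with the covariances `σ`, `π` in closed form)

builds on p205010 (kernel theorem, internal audit signed; external expert review pending)

Support file (`--supports stmt-CriticalPhenomena-4575`), seat `prim-quant-p1` (gen 21); memo
`run/shared/lean/prim/quant/prim-quant-p1-g21/FOR-LEAD-CYCDEC.md` §2–§3, §6(3).  Standard axioms; no sorries; no definitions.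

For a valid `TwoChain` `C` with `n + 1` hubs, `D = C.shift`, hub-1 data `m₁ = C.m 1`, `u₁, s₁, d₁`, and the COVARIANCES of hub 1's
membership with the levels of the other hubs' count, in the closed form of memo §3 (`b = B₁` the wrap probability, `κ = 1 − A₁`):
  `σ = (1 − A₁)·(DN n D + B₁·(omH n D − ZF n D))`,  `π = (1 − A₁)·(GZ n D + GS n D + B₁·((1 − ZF n D − SF n D) − TT n D))`,
this file proves the two STEP IDENTITIES (memo §2; the covariance identity of §3 is built into them)
  `hh (n+1) C = m₁u₁ + (1 − m₁u₁)·hh n D − u₁σ`,   `tt (n+1) C = m₁d₁ + m₁s₁·hh n D + (1 − m₁u₁)·tt n D + s₁σ − u₁π`,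
and the MODEL FACTS used by `Block.dominates_hubStep` (`T/…QuantFarDecStep`): `0 ≤ σ ≤ m₁·(1 − hh n D)`, `σ ≤ (1 − m₁)(1 − omH n D)`,
`0 ≤ π ≤ (1 − m₁)·tt n D`, `π − σ ≤ m₁·(hh n D − tt n D)`, whence `tt n D ≤ tt (n+1) C`, `m₁u₁ ≤ hh (n+1) C`, `hh n D ≤ hh (n+1) C`,
`m₁u₁·hh n D + u₁σ ≤ tt (n+1) C`; and the one-hub base case `hh 1 C = hProd 1 C`, `tt 1 C = tProd 1 C`.
[this work]
-/

namespace Summit.CriticalPhenomena.PercolationContinuityZ3.Theorems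

namespace Quant

namespace Block

namespace TwoChain

open Finset

variable (C : TwoChain) (n : ℕ)

/-- `omH (n+1) C` in terms of the data of hub 1 and the aggregates of `C.shift`. [this work] -/
theorem omH_succ : omH (n + 1) C = C.B 1 * (C.z 1 * ZF n C.shift) + ((C.B 2 - C.B 1) * ZF n C.shift + PE n C.shift)
    - ((C.B 2 - C.B 1) * ZF n C.shift * (C.A 1 * C.u 1) + C.A 1 * C.u 1 * PE n C.shift + C.z 1 * DN n C.shift) := by
  unfold omH; rw [ZF_succ, PE_succ, DN_succ]

/-- `TT (n+1) C` in terms of the data of hub 1 and the aggregates of `C.shift`. [this work] -/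
theorem TT_succ : TT (n + 1) C = C.B 1 * (1 - C.z 1 * ZF n C.shift - (C.s 1 * ZF n C.shift + C.z 1 * SF n C.shift))
    + ((C.B 2 - C.B 1) * ZF n C.shift * (C.A 1 * C.d 1) + C.A 1 * C.d 1 * PE n C.shift + C.s 1 * DN n C.shift
        + C.z 1 * GZ n C.shift)
    + ((C.B 2 - C.B 1) * SF n C.shift * (C.A 1 * C.u 1) + C.A 1 * C.u 1 * PS n C.shift + C.z 1 * GS n C.shift)
    + (1 - C.B 1) - ((C.B 2 - C.B 1) * ZF n C.shift + PE n C.shift) - ((C.B 2 - C.B 1) * SF n C.shift + PS n C.shift) := by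
  unfold TT; rw [ZF_succ, SF_succ, GZ_succ, GS_succ, PE_succ, PS_succ]

/-- `omH n (C.shift)` unfolded with `C.shift.B 1 = C.B 2`. [this work] -/
theorem omH_shift : omH n C.shift = C.B 2 * ZF n C.shift + PE n C.shift - DN n C.shift := rfl

/-- `TT n (C.shift)` unfolded with `C.shift.B 1 = C.B 2`. [this work] -/
theorem TT_shift : TT n C.shift = C.B 2 * (1 - ZF n C.shift - SF n C.shift) + GZ n C.shift + GS n C.shift + (1 - C.B 2)
    - PE n C.shift - PS n C.shift := rfl

variable {C n}

/-- **STEP IDENTITY for `h`** (memo §2–§3): `hh (n+1) C = m₁u₁ + (1 − m₁u₁)·hh n D − u₁·σ`. [this work] -/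
theorem hh_succ_eq (hV : C.Valid (n + 1)) :
    hh (n + 1) C = C.m 1 * C.u 1 + (1 - C.m 1 * C.u 1) * hh n C.shift
      - C.u 1 * ((1 - C.A 1) * (DN n C.shift + C.B 1 * (omH n C.shift - ZF n C.shift))) := by
  unfold hh
  rw [omH_succ, omH_shift]
  unfold m u
  have hz : C.z 1 = 1 - C.s 1 - C.d 1 := by linarith [hV.zsd 1]
  rw [hz]; ring

/-- **STEP IDENTITY for `t`** (memo §2–§3): `tt (n+1) C = m₁d₁ + m₁s₁·hh n D + (1 − m₁u₁)·tt n D + s₁σ − u₁π`. [this work] -/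
theorem tt_succ_eq (hV : C.Valid (n + 1)) :
    tt (n + 1) C = C.m 1 * C.d 1 + C.m 1 * C.s 1 * hh n C.shift + (1 - C.m 1 * C.u 1) * tt n C.shift
      + C.s 1 * ((1 - C.A 1) * (DN n C.shift + C.B 1 * (omH n C.shift - ZF n C.shift)))
      - C.u 1 * ((1 - C.A 1) * (GZ n C.shift + GS n C.shift
          + C.B 1 * ((1 - ZF n C.shift - SF n C.shift) - TT n C.shift))) := by
  unfold tt hh
  rw [TT_succ, TT_shift, omH_shift]
  unfold m u
  have hz : C.z 1 = 1 - C.s 1 - C.d 1 := by linarith [hV.zsd 1]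
  rw [hz]; ring

/-- `0 ≤ σ`. [this work] -/
theorem sigma_nonneg (hV : C.Valid (n + 1)) :
    0 ≤ (1 - C.A 1) * (DN n C.shift + C.B 1 * (omH n C.shift - ZF n C.shift)) := by
  have hD := hV.shift
  have h1 := DN_nonneg hD n
  have h2 : 0 ≤ omH n C.shift - ZF n C.shift := by linarith [ZF_le_omH hD]
  exact mul_nonneg (by linarith [hV.A_le_one 1]) (add_nonneg h1 (mul_nonneg (hV.B_nonneg 1) h2))

/-- `σ ≤ m₁·omH n D` (`= m₁·(1 − hh n D) = m₁·P(X° = 0)`; from `DN ≤ A₁·PE`). [this work] -/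
theorem sigma_le (hV : C.Valid (n + 1)) :
    (1 - C.A 1) * (DN n C.shift + C.B 1 * (omH n C.shift - ZF n C.shift)) ≤ C.m 1 * omH n C.shift := by
  have hD := hV.shift
  rw [omH_shift]; unfold m
  have h1 : DN n C.shift ≤ C.A 1 * PE n C.shift := by
    have := DN_le hD n
    simp only [shift_A] at this
    exact le_trans this (mul_le_mul_of_nonneg_right (hV.A_anti 1) (PE_nonneg hD n))
  have hZ := ZF_nonneg hD n
  have hA0 := hV.A_nonneg 1; have hA1 := hV.A_le_one 1
  have hB1 := hV.B_nonneg 1; have hB2 := hV.B_nonneg 2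
  -- m₁·omH − σ = A₁B₂Z + A₁·PE − DN + (1 − A₁)B₁Z
  nlinarith [mul_nonneg (mul_nonneg hA0 hB2) hZ, mul_nonneg (mul_nonneg (sub_nonneg.mpr hA1) hB1) hZ]

/-- `σ ≤ (1 − m₁)·(1 − omH n D)` (`= (1 − m₁)·hh n D`; from `PE ≤ 1 − B₂`, `ZF ≤ 1`). [this work] -/
theorem sigma_le' (hV : C.Valid (n + 1)) :
    (1 - C.A 1) * (DN n C.shift + C.B 1 * (omH n C.shift - ZF n C.shift)) ≤ (1 - C.m 1) * (1 - omH n C.shift) := by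
  have hD := hV.shift
  have e : 1 - C.m 1 = (1 - C.A 1) * (1 - C.B 1) := by unfold m; ring
  rw [e, mul_assoc]
  apply mul_le_mul_of_nonneg_left _ (by linarith [hV.A_le_one 1])
  rw [omH_shift]
  have h1 := PE_add_PS_le hD
  simp only [shift_B] at h1
  have h2 := PS_nonneg hD n
  have hZ := ZF_le_one hD n
  have hZ0 := ZF_nonneg hD n
  have hB12 : C.B 1 ≤ C.B 2 := hV.B_mono 1
  have hDN := DN_nonneg hD n
  nlinarith [mul_nonneg (sub_nonneg.mpr hB12) (sub_nonneg.mpr hZ), hV.B_nonneg 1]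

/-- `0 ≤ π`. [this work] -/
theorem pi_nonneg (hV : C.Valid (n + 1)) :
    0 ≤ (1 - C.A 1) * (GZ n C.shift + GS n C.shift + C.B 1 * ((1 - ZF n C.shift - SF n C.shift) - TT n C.shift)) := by
  have hD := hV.shift
  have h1 := GZ_nonneg hD n
  have h2 := GS_nonneg hD n
  have h3 : 0 ≤ (1 - ZF n C.shift - SF n C.shift) - TT n C.shift := by linarith [TT_le_D2all hD]
  exact mul_nonneg (by linarith [hV.A_le_one 1]) (add_nonneg (add_nonneg h1 h2) (mul_nonneg (hV.B_nonneg 1) h3))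

/-- `π ≤ (1 − m₁)·tt n D` (from `B₁ ≤ B₂`, `PE + PS ≤ 1 − B₂`). [this work] -/
theorem pi_le (hV : C.Valid (n + 1)) :
    (1 - C.A 1) * (GZ n C.shift + GS n C.shift + C.B 1 * ((1 - ZF n C.shift - SF n C.shift) - TT n C.shift))
      ≤ (1 - C.m 1) * tt n C.shift := by
  have hD := hV.shift
  have e : 1 - C.m 1 = (1 - C.A 1) * (1 - C.B 1) := by unfold m; ring
  rw [e, mul_assoc]
  apply mul_le_mul_of_nonneg_left _ (by linarith [hV.A_le_one 1])
  unfold tt; rw [TT_shift]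
  have h1 := PE_add_PS_le hD
  simp only [shift_B] at h1
  have hD2 : 0 ≤ 1 - ZF n C.shift - SF n C.shift := by linarith [ZF_add_SF_le_one hD n]
  have hB12 : C.B 1 ≤ C.B 2 := hV.B_mono 1
  nlinarith [mul_nonneg (sub_nonneg.mpr hB12) hD2, hV.B_nonneg 1]

/-- `π − σ ≤ m₁·(hh n D − tt n D)` (`= m₁·P(X° = 1)`; from `GZ ≤ DN`, `GS ≤ A₁·PS`). [this work] -/
theorem pi_sub_sigma_le (hV : C.Valid (n + 1)) :
    (1 - C.A 1) * (GZ n C.shift + GS n C.shift + C.B 1 * ((1 - ZF n C.shift - SF n C.shift) - TT n C.shift))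
      - (1 - C.A 1) * (DN n C.shift + C.B 1 * (omH n C.shift - ZF n C.shift))
      ≤ C.m 1 * (hh n C.shift - tt n C.shift) := by
  have hD := hV.shift
  unfold hh tt m; rw [TT_shift, omH_shift]
  have h1 := GZ_le_DN hD n
  have h2 : GS n C.shift ≤ C.A 1 * PS n C.shift := by
    have := GS_le hD n
    simp only [shift_A] at this
    exact le_trans this (mul_le_mul_of_nonneg_right (hV.A_anti 1) (PS_nonneg hD n))
  have hS := SF_nonneg hD n
  have hA0 := hV.A_nonneg 1; have hA1 := hV.A_le_one 1
  have hB1 := hV.B_nonneg 1; have hB2 := hV.B_nonneg 2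
  have hB11 := hV.B_le_one 1; have hB21 := hV.B_le_one 2
  -- m₁E1 − (π − σ) = (DN − GZ) + (A₁PS − GS) + SF·[(A₁ + B₁ − A₁B₁)B₂ + (1 − A₁)B₁(1 − B₂)]
  have hc : 0 ≤ (C.A 1 + C.B 1 - C.A 1 * C.B 1) * C.B 2 + (1 - C.A 1) * C.B 1 * (1 - C.B 2) := by
    nlinarith [mul_nonneg hA0 hB2, mul_nonneg hB1 hB2, mul_nonneg (sub_nonneg.mpr hA1) hB1]
  nlinarith [mul_nonneg hS hc]

/-- `tt n D ≤ tt (n+1) C` (`X ≥ X°`). [this work] -/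
theorem tt_shift_le (hV : C.Valid (n + 1)) : tt n C.shift ≤ tt (n + 1) C := by
  rw [tt_succ_eq hV]
  have h1 := pi_sub_sigma_le hV
  have h2 := sigma_le hV
  have e : C.m 1 * omH n C.shift = C.m 1 * (1 - hh n C.shift) := by unfold hh; ring
  have hu := u_nonneg hV 1
  have hd := hV.d_nonneg 1
  -- t − T° = u₁[m₁E1 − (π − σ)] + d₁[m₁·omH − σ]
  unfold u at *
  nlinarith [mul_nonneg hu (sub_nonneg.mpr h1), mul_nonneg hd (sub_nonneg.mpr h2)]

/-- `hh n D ≤ hh (n+1) C`. [this work] -/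
theorem hh_shift_le (hV : C.Valid (n + 1)) : hh n C.shift ≤ hh (n + 1) C := by
  rw [hh_succ_eq hV]
  have h2 := sigma_le hV
  have e : omH n C.shift = 1 - hh n C.shift := by unfold hh; ring
  rw [e] at h2 ⊢
  have hu := u_nonneg hV 1
  nlinarith [mul_le_mul_of_nonneg_left h2 hu]

/-- `m₁u₁ ≤ hh (n+1) C` (hub 1 alone delivers). [this work] -/
theorem mu_le_hh (hV : C.Valid (n + 1)) : C.m 1 * C.u 1 ≤ hh (n + 1) C := by
  rw [hh_succ_eq hV]
  have h2 := sigma_le' hV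
  have e : 1 - omH n C.shift = hh n C.shift := by unfold hh; ring
  rw [e] at h2
  have hh0 : 0 ≤ hh n C.shift := by
    have := TT_nonneg hV.shift; have := TT_le hV.shift; unfold hh; linarith
  have hu := u_nonneg hV 1; have hu1 := u_le_one hV 1
  have hm := m_nonneg hV 1; have hm1 := m_le_one hV 1
  -- (1 − m₁u₁)hh_D − u₁σ ≥ (1 − m₁u₁)hh_D − u₁(1 − m₁)hh_D = (1 − u₁)hh_D ≥ 0
  nlinarith [mul_le_mul_of_nonneg_left h2 hu, mul_nonneg (sub_nonneg.mpr hu1) hh0]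

/-- `m₁u₁·hh n D + u₁σ ≤ tt (n+1) C` (`P(hub 1 delivers and X° ≥ 1) ≤ P(X ≥ 2)`). [this work] -/
theorem mu_hh_le_tt (hV : C.Valid (n + 1)) :
    C.m 1 * C.u 1 * hh n C.shift + C.u 1 * ((1 - C.A 1) * (DN n C.shift + C.B 1 * (omH n C.shift - ZF n C.shift)))
      ≤ tt (n + 1) C := by
  rw [tt_succ_eq hV]
  have h1 := pi_le hV
  have h2 := sigma_le hV
  have e : C.m 1 * omH n C.shift = C.m 1 * (1 - hh n C.shift) := by unfold hh; ring
  have hu := u_nonneg hV 1; have hu1 := u_le_one hV 1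
  have hd := hV.d_nonneg 1
  have hm := m_nonneg hV 1
  have ht0 : 0 ≤ tt n C.shift := TT_nonneg hV.shift
  -- t − (m₁u₁H + u₁σ) = d₁(m₁·omH − σ) + [(1 − m₁u₁)T − u₁π], and u₁π ≤ u₁(1 − m₁)T ≤ (1 − m₁u₁)T
  unfold u at *
  nlinarith [mul_nonneg hd (sub_nonneg.mpr h2), mul_le_mul_of_nonneg_left h1 hu,
    mul_nonneg (sub_nonneg.mpr hu1) (mul_nonneg hm ht0)]

/-- One hub: the true and the decoupled numbers coincide (`hh 1 C = hProd 1 C`). [this work] -/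
theorem hh_one (hV : C.Valid 1) : hh 1 C = hProd 1 C := by
  rw [hh_succ_eq hV, hProd_succ, hProd_zero]
  have hB : C.B 2 = 1 := hV.B_top 2 le_rfl
  have e1 : hh 0 C.shift = 0 := by unfold hh omH PE DN; simp [hB]
  have e2 : omH 0 C.shift = 1 := by unfold omH PE DN; simp [hB]
  have e3 : DN 0 C.shift = 0 := by unfold DN; simp
  rw [e1, e2, e3]; simp

/-- One hub: `tt 1 C = tProd 1 C`. [this work] -/
theorem tt_one (hV : C.Valid 1) : tt 1 C = tProd 1 C := by
  rw [tt_succ_eq hV, tProd_succ, tProd_zero, hProd_zero]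
  have hB : C.B 2 = 1 := hV.B_top 2 le_rfl
  have e1 : hh 0 C.shift = 0 := by unfold hh omH PE DN; simp [hB]
  have e2 : omH 0 C.shift = 1 := by unfold omH PE DN; simp [hB]
  have e3 : DN 0 C.shift = 0 := by unfold DN; simp
  have e4 : tt 0 C.shift = 0 := by unfold tt TT GZ GS PE PS; simp [hB]
  have e5 : TT 0 C.shift = 0 := by unfold TT GZ GS PE PS; simp [hB]
  have e6 : GZ 0 C.shift = 0 := by unfold GZ; simp
  have e7 : GS 0 C.shift = 0 := by unfold GS; simp
  rw [e1, e2, e3, e4, e5, e6, e7]; simp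

end TwoChain

end Block

end Quant

end Summit.CriticalPhenomena.PercolationContinuityZ3.Theorems
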